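import Mathlib.NumberTheory.NumberField.DedekindZeta
import Literature.NumberTheory.NumberFields.RegulatorLowerBound
import HarnessLib

/-!
# An effective lower bound for the residue of `ζ_K` at `s = 1`, for EVERY number field of degree `≤ n`

Topic `Literature/NumberTheory/NumberFields`, namespace `Literature.NumberTheory.NumberFields`.
Everything here is PROVED (theorems only, no definitions).

`exists_residue_ge_div_sqrt_of_finrank_le`: for every `n` there is an (effective) `c > 0` such
that every number field `K` with `[K:ℚ] ≤ n` has
`κ_K = Res_{s=1} ζ_K(s) ≥ c / √|d_K|`.
This is the trivial effective direction of the Brauer–Siegel theorem: Mathlib DEFINES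
`NumberField.dedekindZeta_residue K` by the analytic class number formula
`2^{r₁} (2π)^{r₂} R_K h_K / (w_K √|d_K|)` (and proves it is the residue,
`NumberField.tendsto_sub_one_mul_dedekindZeta_nhdsGT`), so the bound follows from `h_K ≥ 1`, the
regulator lower bound `R_K ≥ c_R(n)` (`RegulatorLowerBound.lean`, Minkowski + Kronecker) and
`w_K ≤ W(n)` (`UnitHeightGap.lean`).  No zero-free region, no hypothesis on quadratic subfields, no
Siegel-type ineffectivity: fields WITH quadratic subfields are covered (this is what Stark's
`κ_K ≫ (c₁ n)^{-n} / (…)` results do without the class number formula for `K`; here the class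
number formula is the definition).

## References
* H. M. Stark, *Some effective cases of the Brauer–Siegel theorem*, Invent. Math. 23 (1974)
  135–152, §1 (context: effective lower bounds for `κ_K`). [Stark1974]
* R. Brauer, *On the zeta-functions of algebraic number fields*, Amer. J. Math. 69 (1947) — the
  Brauer–Siegel theorem (ineffective two-sided asymptotics); we prove only the trivial effective side.
* Mathlib, `Mathlib/NumberTheory/NumberField/DedekindZeta.lean` (X. Roblot, 2025).
-/

open Module NumberField NumberField.InfinitePlace NumberField.Units

namespace Literature.NumberTheory.NumberFields

/-- **`κ_K ≥ c(n)/√|d_K|` for every number field of degree `≤ n`** (effective; `c(n) > 0` depends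
only on `n`): from the class number formula (Mathlib's definition of `dedekindZeta_residue`),
`h_K ≥ 1`, `R_K ≥ c_R(n)` and `w_K ≤ W(n)`. [cite: Stark1974, §1 (trivial effective Brauer–Siegel direction)] -/
theorem exists_residue_ge_div_sqrt_of_finrank_le (n : ℕ) :
    ∃ c : ℝ, 0 < c ∧ ∀ (K : Type) [Field K] [NumberField K], finrank ℚ K ≤ n →
      c / Real.sqrt |(discr K : ℝ)| ≤ dedekindZeta_residue K := by
  obtain ⟨cR, hcR, hreg⟩ := exists_regulator_ge_of_finrank_le n
  obtain ⟨W, hW⟩ := exists_torsionOrder_le_of_finrank_le n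
  refine ⟨cR / max (W : ℝ) 1, by positivity, fun K _ _ hK => ?_⟩
  have hd : 0 < Real.sqrt |(discr K : ℝ)| :=
    Real.sqrt_pos.mpr (abs_pos.mpr (Int.cast_ne_zero.mpr (discr_ne_zero K)))
  have hw0 : (0 : ℝ) < torsionOrder K := by exact_mod_cast torsionOrder_pos K
  have hwW : (torsionOrder K : ℝ) ≤ max (W : ℝ) 1 :=
    le_trans (by exact_mod_cast hW K hK) (le_max_left _ _)
  -- numerator ≥ c_R
  have h1 : (1 : ℝ) ≤ 2 ^ nrRealPlaces K := one_le_pow₀ (by norm_num)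
  have h2 : (1 : ℝ) ≤ (2 * Real.pi) ^ nrComplexPlaces K :=
    one_le_pow₀ (by linarith [Real.pi_gt_three])
  have h3 : cR ≤ regulator K := hreg K hK
  have h4 : (1 : ℝ) ≤ classNumber K := by exact_mod_cast classNumber_pos K
  have hnum : cR ≤ 2 ^ nrRealPlaces K * (2 * Real.pi) ^ nrComplexPlaces K * regulator K * classNumber K := by
    have h12 : (1 : ℝ) ≤ 2 ^ nrRealPlaces K * (2 * Real.pi) ^ nrComplexPlaces K := one_le_mul_of_one_le_of_one_le h1 h2
    calc cR = 1 * cR * 1 := by ring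
      _ ≤ (2 ^ nrRealPlaces K * (2 * Real.pi) ^ nrComplexPlaces K) * regulator K * classNumber K :=
          mul_le_mul (mul_le_mul h12 h3 hcR.le (by positivity)) h4 zero_le_one
            (mul_nonneg (by positivity) (regulator_pos K).le)
  rw [dedekindZeta_residue_def]
  calc cR / max (W : ℝ) 1 / Real.sqrt |(discr K : ℝ)|
        = cR / (max (W : ℝ) 1 * Real.sqrt |(discr K : ℝ)|) := by rw [div_div]
    _ ≤ cR / (torsionOrder K * Real.sqrt |(discr K : ℝ)|) := by
          apply div_le_div_of_nonneg_left hcR.le (by positivity)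
          gcongr
    _ ≤ 2 ^ nrRealPlaces K * (2 * Real.pi) ^ nrComplexPlaces K * regulator K * classNumber K /
          (torsionOrder K * Real.sqrt |(discr K : ℝ)|) :=
          div_le_div_of_nonneg_right hnum (by positivity)

/-- The degree-`n` slice: **`κ_K ≥ c(n)/√|d_K|` for every number field of degree `n`.**
[cite: Stark1974, §1 (trivial effective Brauer–Siegel direction)] -/
theorem exists_residue_ge_div_sqrt_of_finrank_eq (n : ℕ) :
    ∃ c : ℝ, 0 < c ∧ ∀ (K : Type) [Field K] [NumberField K], finrank ℚ K = n →
      c / Real.sqrt |(discr K : ℝ)| ≤ dedekindZeta_residue K := by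
  obtain ⟨c, hc, h⟩ := exists_residue_ge_div_sqrt_of_finrank_le n
  exact ⟨c, hc, fun K _ _ hK => h K hK.le⟩

end Literature.NumberTheory.NumberFields
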